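import Summits.CriticalPhenomena.PercolationContinuityZ3.Theorems.PercNearOneGluingNoHeavyLowerTailIncStarDegreeTwoRootFibre
import HarnessLib

/-!
# R23 at an isolated root: the base case of the vertex induction for the R23 margin

Support file for the Sahi programme (`--supports stmt-CriticalPhenomena-4575`, prover prim-sahi-p2 gen 31).  No definitions, no named facts, no
sorries; standard axioms.  Memo `run/shared/lean/prim/prim-sahi/FROM-prim-sahi-p2-gen31-R23-ROOT-FIBRES.md` §4–§5, `prim-sahi-p2/PROOF-E3.md` §41.

Gen 30 reduced the increasing star to R23 along root–unmarked pairs `e = s(s,z)`: `2·E₃(P_{w[e↦1]}) ≤ 3·polar₁(P_{w[e↦1]}, P_{w[e↦0]})` for the star events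
`{s↔b},{s↔c},{s↔y}` (`IncStar.incStar_nonneg_of_ratio23'`).  Gen 31 proposes to prove R23 by induction on the vertices through the FULL expansion of the R23 margin over
the other root pairs (memo §4); the present file is the BASE CASE of that induction ('Case A'): if the root `s` carries no non-loop pair of positive weight other than `e`,
then with `ζ_U = P_w(U ⊆ C_z^{sᶜ})` (the cluster of `z` avoiding `s`) one has `P_{w[e↦0]}(C_s ⊇ U) = 0`, `P_{w[e↦1]}(C_s ⊇ U) = ζ_U` (gen 29's root-fibre dictionary
`IncStar.real_pin_principal`), hence
  `3·polar₁ − 2·E₃ = Σ_t ζ_t·(ζ_{jk} − ζ_jζ_k) + ζ_bζ_cζ_y ≥ 0`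
by Harris' inequality for the increasing events `{j,k ∈ C_z^{sᶜ}}`.

* `r23_of_isolatedRoot` — R23 along `e = s(s,z)` whenever `w s(s,x) = 0` for every `x ∉ {s, z}` (an auxiliary vertex `u ∉ {s,z}` is taken as an argument to instantiate the
  two-pair dictionary; any third vertex will do).
-/

noncomputable section

namespace Summit.CriticalPhenomena.PercolationContinuityZ3.Theorems

namespace IncStar

open MeasureTheory Set Literature.Probability.Percolation Literature.Probability.LatticeModels EdgeInduction
open scoped Classical

variable {n : ℕ}

/-- **R23 AT AN ISOLATED ROOT (Case A of the vertex induction).**  Let `s ≠ z` and suppose every pair `s(s,x)` with `x ∉ {s,z}` has weight `0`.  Then for all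
targets `b, c, y ≠ s`, along `e = s(s,z)`: `2·E₃(P_{w[e↦1]}) ≤ 3·polar₁(P_{w[e↦1]}, P_{w[e↦0]})` for the star events `{s↔b},{s↔c},{s↔y}`.  (`u` is any third vertex;
with `ζ_U = P_w(U ⊆ C_z^{sᶜ})` the margin equals `Σ_t ζ_t(ζ_{jk} − ζ_jζ_k) + ζ_bζ_cζ_y`.) [this work] -/
theorem r23_of_isolatedRoot (w : Sym2 (Fin n) → unitInterval) {s z u b c y : Fin n} (hzs : z ≠ s) (hus : u ≠ s) (huz : u ≠ z)
    (hw : ∀ x : Fin n, x ≠ s → x ≠ z → w s(s, x) = 0) (hb : b ≠ s) (hc : c ≠ s) (hy : y ≠ s) :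
    2 * sahiE3 (prodBernoulli (Function.update w s(s, z) 1)) (openConn s b) (openConn s c) (openConn s y) ≤
      3 * polar₁ (prodBernoulli (Function.update w s(s, z) 1)) (prodBernoulli (Function.update w s(s, z) 0))
        (openConn s b) (openConn s c) (openConn s y) := by
  -- the two-pair dictionary of gen 29 with the pairs `s(s,u)` (weight already `0`) and `s(s,z)`
  have hwu : w s(s, u) = 0 := hw u hus huz
  have hw' : ∀ x : Fin n, x ≠ s → x ≠ u → x ≠ z → w s(s, x) = 0 := fun x hx _ hxz => hw x hx hxz
  have hupd : Function.update w s(s, u) 0 = w := by rw [← hwu, Function.update_eq_self]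
  have hpin1 : pin₂ w s(s, u) s(s, z) 0 1 = prodBernoulli (Function.update w s(s, z) 1) := by
    simp only [pin₂, hupd]
  have hpin0 : pin₂ w s(s, u) s(s, z) 0 0 = prodBernoulli (Function.update w s(s, z) 0) := by
    simp only [pin₂, hupd]
  set S : Set (Fin n) := ((({s} : Finset (Fin n)) : Set (Fin n)))ᶜ with hS
  set Vb : Set (BondConfig (Fin n)) := openConnIn S z b with hVb
  set Vc : Set (BondConfig (Fin n)) := openConnIn S z c with hVc
  set Vy : Set (BondConfig (Fin n)) := openConnIn S z y with hVy
  -- the `P⁰` values vanish (root a.s. isolated)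
  have z1 : (prodBernoulli (Function.update w s(s, z) 0)).real (openConn s b) = 0 := by
    rw [← hpin0]; simpa using real_openConn_pin00 w hw' hb Set.univ
  have z2 : (prodBernoulli (Function.update w s(s, z) 0)).real (openConn s c) = 0 := by
    rw [← hpin0]; simpa using real_openConn_pin00 w hw' hc Set.univ
  have z3 : (prodBernoulli (Function.update w s(s, z) 0)).real (openConn s y) = 0 := by
    rw [← hpin0]; simpa using real_openConn_pin00 w hw' hy Set.univ
  have z4 : (prodBernoulli (Function.update w s(s, z) 0)).real (openConn s b ∩ openConn s c ∩ openConn s y) = 0 := by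
    rw [← hpin0, Set.inter_assoc]; exact real_openConn_pin00 w hw' hb _
  have z5 : (prodBernoulli (Function.update w s(s, z) 0)).real (openConn s b ∩ openConn s c) = 0 := by
    rw [← hpin0]; exact real_openConn_pin00 w hw' hb _
  have z6 : (prodBernoulli (Function.update w s(s, z) 0)).real (openConn s b ∩ openConn s y) = 0 := by
    rw [← hpin0]; exact real_openConn_pin00 w hw' hb _
  have z7 : (prodBernoulli (Function.update w s(s, z) 0)).real (openConn s c ∩ openConn s y) = 0 := by
    rw [← hpin0]; exact real_openConn_pin00 w hw' hc _
  -- the `P¹` values are the probabilities of the cluster of `z` avoiding `s`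
  have ne1 : ∀ t : Fin n, ({t} : Finset (Fin n)).Nonempty := fun t => Finset.singleton_nonempty t
  have hU1 : ∀ t : Fin n, t ≠ s → ∀ x ∈ ({t} : Finset (Fin n)), x ≠ s := by
    intro t ht x hx; rw [Finset.mem_singleton] at hx; rw [hx]; exact ht
  have hU2 : ∀ t t' : Fin n, t ≠ s → t' ≠ s → ∀ x ∈ ({t, t'} : Finset (Fin n)), x ≠ s := by
    intro t t' ht ht' x hx
    rw [Finset.mem_insert, Finset.mem_singleton] at hx
    rcases hx with rfl | rfl
    · exact ht
    · exact ht'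
  have hU3 : ∀ x ∈ ({b, c, y} : Finset (Fin n)), x ≠ s := by
    intro x hx
    rw [Finset.mem_insert, Finset.mem_insert, Finset.mem_singleton] at hx
    rcases hx with rfl | rfl | rfl
    · exact hb
    · exact hc
    · exact hy
  have o1 : (prodBernoulli (Function.update w s(s, z) 1)).real (openConn s b) = (prodBernoulli w).real Vb := by
    have h := real_pin01_principal w hus hzs huz hw' {b} (ne1 b) (hU1 b hb)
    rwa [rootFibre_biInter_single, rootFibre_biInter_single, hpin1] at h
  have o2 : (prodBernoulli (Function.update w s(s, z) 1)).real (openConn s c) = (prodBernoulli w).real Vc := by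
    have h := real_pin01_principal w hus hzs huz hw' {c} (ne1 c) (hU1 c hc)
    rwa [rootFibre_biInter_single, rootFibre_biInter_single, hpin1] at h
  have o3 : (prodBernoulli (Function.update w s(s, z) 1)).real (openConn s y) = (prodBernoulli w).real Vy := by
    have h := real_pin01_principal w hus hzs huz hw' {y} (ne1 y) (hU1 y hy)
    rwa [rootFibre_biInter_single, rootFibre_biInter_single, hpin1] at h
  have o5 : (prodBernoulli (Function.update w s(s, z) 1)).real (openConn s b ∩ openConn s c) = (prodBernoulli w).real (Vb ∩ Vc) := by
    have h := real_pin01_principal w hus hzs huz hw' {b, c} ⟨b, by simp⟩ (hU2 b c hb hc)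
    rwa [rootFibre_biInter_pair, rootFibre_biInter_pair, hpin1] at h
  have o6 : (prodBernoulli (Function.update w s(s, z) 1)).real (openConn s b ∩ openConn s y) = (prodBernoulli w).real (Vb ∩ Vy) := by
    have h := real_pin01_principal w hus hzs huz hw' {b, y} ⟨b, by simp⟩ (hU2 b y hb hy)
    rwa [rootFibre_biInter_pair, rootFibre_biInter_pair, hpin1] at h
  have o7 : (prodBernoulli (Function.update w s(s, z) 1)).real (openConn s c ∩ openConn s y) = (prodBernoulli w).real (Vc ∩ Vy) := by
    have h := real_pin01_principal w hus hzs huz hw' {c, y} ⟨c, by simp⟩ (hU2 c y hc hy)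
    rwa [rootFibre_biInter_pair, rootFibre_biInter_pair, hpin1] at h
  have o4 : (prodBernoulli (Function.update w s(s, z) 1)).real (openConn s b ∩ openConn s c ∩ openConn s y) =
      (prodBernoulli w).real (Vb ∩ Vc ∩ Vy) := by
    have h := real_pin01_principal w hus hzs huz hw' {b, c, y} ⟨b, by simp⟩ hU3
    rwa [rootFibre_biInter_triple, rootFibre_biInter_triple, hpin1] at h
  -- Harris for the increasing events `V_t`
  have hVb : IsUpperSet Vb := isUpperSet_openConnIn S z b
  have hVc : IsUpperSet Vc := isUpperSet_openConnIn S z c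
  have hVy : IsUpperSet Vy := isUpperSet_openConnIn S z y
  have hbc := prodBernoulli_harris w hVb hVc (Set.toFinite _).measurableSet (Set.toFinite _).measurableSet
  have hby := prodBernoulli_harris w hVb hVy (Set.toFinite _).measurableSet (Set.toFinite _).measurableSet
  have hcy := prodBernoulli_harris w hVc hVy (Set.toFinite _).measurableSet (Set.toFinite _).measurableSet
  have nb : 0 ≤ (prodBernoulli w).real Vb := measureReal_nonneg
  have nc : 0 ≤ (prodBernoulli w).real Vc := measureReal_nonneg
  have ny : 0 ≤ (prodBernoulli w).real Vy := measureReal_nonneg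
  simp only [sahiE3, polar₁, z1, z2, z3, z4, z5, z6, z7, o1, o2, o3, o4, o5, o6, o7]
  nlinarith [mul_le_mul_of_nonneg_left hbc ny, mul_le_mul_of_nonneg_left hby nc, mul_le_mul_of_nonneg_left hcy nb,
    mul_nonneg (mul_nonneg nb nc) ny]

end IncStar

end Summit.CriticalPhenomena.PercolationContinuityZ3.Theorems

end
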